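import Summits.Ventures.Crystal3D.Bulk.HullRotSys
import HarnessLib

/-!
# The hull rotation system, part 5: `σ_H` IS the cyclic azimuth successor at every vertex
# (brick (G2) of `phase2/LEAN-FACES-DESIGN.md` §5.3 — the bridge to the azimuth order used by
# the oriented tight rotation `onextNbr`, for the wiring (G3))

HONEST FRAMING. Part of the venture `Summits/Ventures/Crystal3D` (cell `pub-crystal3d`, phase 2;
seat p3), generic and configuration-free (`X` any finite set of unit vectors of `ℝ³` with
`0 ∈ interior (conv X)`); nothing here mentions GAP(1.26). The vertex rotation `σ_H = hullSucc X`
of `Bulk/HullRotSys.lean` is defined FRAME-FREE (`orient3 y a (succV X y a) > 0`). The Literature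
(`SphericalCodeHullVertexLink`) enumerates the fan neighbours of a vertex `y` by increasing
azimuth in the tangent frame `tangentFrame y hy` (`NbrEnum`: `nb 0, …, nb (d−1)`, `d`-periodic),
a frame whose handedness `det := orient3 (frame 0) (frame 1) (frame 2) = ±1` is unspecified — the
same frame and azimuth typer-bulk-2's `onextNbr` / `frameDet` use at the directions `gapDir c i`.
This file identifies the two:

* `tri_mem_fanTriSets` — every consecutive triple `{y, nb k, nb (k+1)}` IS a fan triangle
  (the Literature proves the converse, `exists_tri_eq`); `three_le_d`;
* `orient3_nb_mul_pos` / `orient3_nb_pos_iff` — the orientations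
  `O_k = orient3 y (nb k) (nb (k+1))` all have the same sign (oppositely oriented triangles on
  each dart, `orient3_mul_orient3_neg`);
* **`succV_nb_forward` / `succV_nb_backward`** — hence `σ_H (nb k) = nb (k+1)` for ALL `k`, or
  `σ_H (nb (k+1)) = nb k` for ALL `k`, according to that sign;
* **`sin_azimuth_gap_pos`** — every cyclically consecutive azimuth gap has positive sine (so is
  `< π`: `azimuth_gap_lt_pi`, `azimuth_wrap_gap_lt_pi`): by `orient3_polar`,
  `O_k = r_k r_{k+1} sin(gap_k) · det`, the sines share one sign, and all-negative would make the
  gaps sum to more than `2π`;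
* **`orient3_nb_pos_iff_det_pos`**, **`succV_nb_of_det_pos` / `succV_nb_of_det_neg`** — the sign
  is the handedness of the frame: `σ_H` steps FORWARD in azimuth iff `det > 0` (the `onextNbr`
  convention: `nextNbr` if `frameDet = 1`, `prevNbr` otherwise).

What (G3) then needs is index arithmetic: tight partners are fan neighbours (tight pairs are hull
edges), both rotations step to the cyclically next element of their azimuth-sorted lists in the
direction fixed by the same `det`, so the first return of `σ_H` to the tight darts is `onextNbr`.
-/

noncomputable section

namespace Summit.Ventures.Crystal3D

namespace HullRotSys

open Literature.Geometry.DiscreteGeometry Finset Real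

variable {X : Finset (EuclideanSpace ℝ (Fin 3))} {y : EuclideanSpace ℝ (Fin 3)} {hy : ‖y‖ = 1}

/-! ## Consecutive triples are fan triangles -/

/-- `(y, nb k)` is a dart. -/
theorem NbrEnum_dart (E : NbrEnum X y hy) (k : ℕ) : (y, E.nb k) ∈ hullDarts X :=
  mk_mem_hullDarts_iff.2 (E.mem k)

/-- Index step modulo the period: `nb k = nb j → nb (k + 1) = nb (j + 1)`. -/
theorem NbrEnum_nb_succ_congr (E : NbrEnum X y hy) {k j : ℕ} (h : E.nb k = E.nb j) :
    E.nb (k + 1) = E.nb (j + 1) := by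
  have hmod := E.mod_eq_of_nb_eq h
  rw [← E.nb_mod (k + 1), ← E.nb_mod (j + 1), Nat.add_mod, hmod, ← Nat.add_mod]

/-- **Every consecutive triple `tri k = {y, nb k, nb (k+1)}` is a fan triangle.** (The two fan
triangles on the dart `(y, nb k)` are triangles at `y`, hence of the form `tri j` with
`nb k ∈ tri j`, i.e. `j ≡ k` or `j + 1 ≡ k`; they are distinct, so one of them is `tri k`.) -/
theorem tri_mem_fanTriSets (hX1 : ∀ y ∈ X, ‖y‖ = 1)
    (h0 : (0 : EuclideanSpace ℝ (Fin 3)) ∈ interior (convexHull ℝ (X : Set _)))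
    (E : NbrEnum X y hy) (k : ℕ) : E.tri k ∈ fanTriSets X := by
  obtain ⟨b₁, b₂, h₁₂, h₁, h₂, hy₁, ha₁, hy₂, ha₂, -⟩ := exists_two_thirds hX1 h0 (NbrEnum_dart E k)
  -- each triangle is some `tri j` with `nb k ∈ {nb j, nb (j+1)}`
  have key : ∀ b : EuclideanSpace ℝ (Fin 3), ({y, E.nb k, b} : Finset _) ∈ fanTriSets X →
      y ≠ b → E.nb k ≠ b → E.tri k ∈ fanTriSets X ∨ ∃ j, b = E.nb j ∧ E.nb k = E.nb (j + 1) := by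
    intro b hb hyb hkb
    obtain ⟨j, -, hj⟩ := E.exists_tri_eq hX1 (mem_trisAt.2 ⟨hb, by simp⟩)
    have hkm : E.nb k ∈ E.tri j := by rw [← hj]; simp
    have hbm : b ∈ E.tri j := by rw [← hj]; simp
    unfold NbrEnum.tri at hkm hbm hj
    simp only [mem_insert, mem_singleton] at hkm hbm
    rcases hkm with hky | hkj | hkj1
    · exact absurd hky (E.nb_ne k)
    · -- `nb k = nb j`: the triangle is `tri k`
      left
      have hk1 : E.nb (k + 1) = E.nb (j + 1) := NbrEnum_nb_succ_congr E hkj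
      rcases hbm with hby | hbj | hbj1
      · exact absurd hby.symm hyb
      · exact absurd (hkj.trans hbj.symm) hkb
      · unfold NbrEnum.tri
        rw [hk1, ← hbj1]; exact hb
    · -- `nb k = nb (j+1)`: then `b = nb j`
      right
      rcases hbm with hby | hbj | hbj1
      · exact absurd hby.symm hyb
      · exact ⟨j, hbj, hkj1⟩
      · exact absurd (hkj1.trans hbj1.symm) hkb
  rcases key b₁ h₁ hy₁ ha₁ with h | ⟨j₁, hb₁, hk₁⟩
  · exact h
  rcases key b₂ h₂ hy₂ ha₂ with h | ⟨j₂, hb₂, hk₂⟩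
  · exact h
  -- both `b₁ = nb j₁`, `b₂ = nb j₂` with `j₁ + 1 ≡ k ≡ j₂ + 1`: then `b₁ = b₂`
  exfalso
  apply h₁₂
  have hmod : (j₁ + 1) % E.d = (j₂ + 1) % E.d := E.mod_eq_of_nb_eq (hk₁.symm.trans hk₂)
  have hj : j₁ % E.d = j₂ % E.d :=
    Nat.ModEq.add_right_cancel' 1 hmod
  rw [hb₁, hb₂, ← E.nb_mod j₁, ← E.nb_mod j₂, hj]

/-- A vertex has at least three fan neighbours. -/
theorem three_le_d (hX1 : ∀ y ∈ X, ‖y‖ = 1)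
    (h0 : (0 : EuclideanSpace ℝ (Fin 3)) ∈ interior (convexHull ℝ (X : Set _)))
    (E : NbrEnum X y hy) : 3 ≤ E.d := by
  obtain ⟨b₁, b₂, h₁₂, h₁, h₂, hy₁, ha₁, hy₂, ha₂, -⟩ := exists_two_thirds hX1 h0 (NbrEnum_dart E 0)
  have hb₁ : b₁ ∈ fanNbrs X y :=
    mk_mem_hullDarts_iff.1 (mk_mem_hullDarts h₁ (by simp) (by simp) hy₁)
  have hb₂ : b₂ ∈ fanNbrs X y :=
    mk_mem_hullDarts_iff.1 (mk_mem_hullDarts h₂ (by simp) (by simp) hy₂)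
  have hsub : ({E.nb 0, b₁, b₂} : Finset _) ⊆ fanNbrs X y := by
    intro z hz
    simp only [mem_insert, mem_singleton] at hz
    rcases hz with rfl | rfl | rfl
    · exact E.mem 0
    · exact hb₁
    · exact hb₂
  have h3 : ({E.nb 0, b₁, b₂} : Finset _).card = 3 := by
    rw [card_insert_of_notMem, card_pair h₁₂]
    simp only [mem_insert, mem_singleton, not_or]
    exact ⟨ha₁, ha₂⟩
  have hle := card_le_card hsub
  rw [h3, E.card_eq] at hle
  exact hle

/-! ## The orientations `O_k = orient3 y (nb k) (nb (k+1))` share one sign -/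

/-- Consecutive orientations have a positive product (the two triangles `tri k`, `tri (k+1)` on
the dart `(y, nb (k+1))` are oppositely oriented as seen from that dart). -/
theorem orient3_nb_mul_pos (hX1 : ∀ y ∈ X, ‖y‖ = 1)
    (h0 : (0 : EuclideanSpace ℝ (Fin 3)) ∈ interior (convexHull ℝ (X : Set _)))
    (E : NbrEnum X y hy) (k : ℕ) :
    0 < orient3 y (E.nb k) (E.nb (k + 1)) * orient3 y (E.nb (k + 1)) (E.nb (k + 2)) := by
  have hd := three_le_d hX1 h0 E
  have t₁ : ({y, E.nb (k + 1), E.nb k} : Finset _) ∈ fanTriSets X := by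
    have h := tri_mem_fanTriSets hX1 h0 E k
    unfold NbrEnum.tri at h
    rw [pair_comm]; exact h
  have t₂ : ({y, E.nb (k + 1), E.nb (k + 2)} : Finset _) ∈ fanTriSets X :=
    tri_mem_fanTriSets hX1 h0 E (k + 1)
  have n01 : E.nb k ≠ E.nb (k + 1) := E.nb_ne_nb_add Nat.one_pos (by omega)
  have n12 : E.nb (k + 1) ≠ E.nb (k + 2) := E.nb_ne_nb_add Nat.one_pos (by omega)
  have n02 : E.nb k ≠ E.nb (k + 2) := E.nb_ne_nb_add two_pos (by omega)
  have h := orient3_mul_orient3_neg hX1 t₁ t₂ (E.nb_ne _).symm (E.nb_ne _).symm n01.symm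
    (E.nb_ne _).symm n12 n02
  rw [orient3_swap_right y (E.nb (k + 1)) (E.nb k)] at h
  linarith

/-- All orientations have the sign of the first. -/
theorem orient3_nb_pos_iff (hX1 : ∀ y ∈ X, ‖y‖ = 1)
    (h0 : (0 : EuclideanSpace ℝ (Fin 3)) ∈ interior (convexHull ℝ (X : Set _)))
    (E : NbrEnum X y hy) (k : ℕ) :
    0 < orient3 y (E.nb k) (E.nb (k + 1)) ↔ 0 < orient3 y (E.nb 0) (E.nb 1) := by
  induction k with
  | zero => exact Iff.rfl
  | succ k ih =>
    rw [← ih]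
    exact (pos_iff_pos_of_mul_pos (orient3_nb_mul_pos hX1 h0 E k)).symm

/-- The first orientation is nonzero. -/
theorem orient3_nb_ne_zero (hX1 : ∀ y ∈ X, ‖y‖ = 1)
    (h0 : (0 : EuclideanSpace ℝ (Fin 3)) ∈ interior (convexHull ℝ (X : Set _)))
    (E : NbrEnum X y hy) (k : ℕ) : orient3 y (E.nb k) (E.nb (k + 1)) ≠ 0 :=
  left_ne_zero_of_mul (orient3_nb_mul_pos hX1 h0 E k).ne'

/-- **`σ_H` steps forward in the enumeration at every position**, if the first orientation is
positive. -/
theorem succV_nb_forward (hX1 : ∀ y ∈ X, ‖y‖ = 1)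
    (h0 : (0 : EuclideanSpace ℝ (Fin 3)) ∈ interior (convexHull ℝ (X : Set _)))
    (E : NbrEnum X y hy) (hpos : 0 < orient3 y (E.nb 0) (E.nb 1)) (k : ℕ) :
    succV X y (E.nb k) = E.nb (k + 1) :=
  (succV_eq_iff hX1 h0 (NbrEnum_dart E k)).2
    ⟨tri_mem_fanTriSets hX1 h0 E k, (orient3_nb_pos_iff hX1 h0 E k).2 hpos⟩

/-- **`σ_H` steps backward in the enumeration at every position**, if the first orientation is
negative. -/
theorem succV_nb_backward (hX1 : ∀ y ∈ X, ‖y‖ = 1)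
    (h0 : (0 : EuclideanSpace ℝ (Fin 3)) ∈ interior (convexHull ℝ (X : Set _)))
    (E : NbrEnum X y hy) (hneg : orient3 y (E.nb 0) (E.nb 1) < 0) (k : ℕ) :
    succV X y (E.nb (k + 1)) = E.nb k := by
  refine (succV_eq_iff hX1 h0 (NbrEnum_dart E (k + 1))).2 ⟨?_, ?_⟩
  · have h := tri_mem_fanTriSets hX1 h0 E k
    unfold NbrEnum.tri at h
    rw [pair_comm]; exact h
  · have hk : ¬ 0 < orient3 y (E.nb k) (E.nb (k + 1)) := fun h =>
      absurd ((orient3_nb_pos_iff hX1 h0 E k).1 h) (not_lt.2 hneg.le)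
    rw [orient3_swap_right]
    rcases lt_or_gt_of_ne (orient3_nb_ne_zero hX1 h0 E k) with h | h
    · linarith
    · exact absurd h hk

/-! ## The sign is the handedness of the tangent frame; all azimuth gaps are `< π` -/

/-- The product formula for consecutive neighbours:
`O_k = r_k · r_{k+1} · sin(θ_{k+1} − θ_k) · det`. -/
theorem orient3_nb_eq_polar (hX1 : ∀ y ∈ X, ‖y‖ = 1) (E : NbrEnum X y hy) (k : ℕ) :
    orient3 y (E.nb k) (E.nb (k + 1)) =
      trad y (E.nb k) * trad y (E.nb (k + 1)) *
        Real.sin (azimuth y hy (E.nb (k + 1)) - azimuth y hy (E.nb k)) *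
        orient3 (tangentFrame y hy 0) (tangentFrame y hy 1) (tangentFrame y hy 2) := by
  have pa : PolarRep y hy (E.nb k) (azimuth y hy (E.nb k)) :=
    polarRep_azimuth (norm_eq_one_of_mem_fanNbrs hX1 (E.mem k))
  have pb : PolarRep y hy (E.nb (k + 1)) (azimuth y hy (E.nb (k + 1))) :=
    polarRep_azimuth (norm_eq_one_of_mem_fanNbrs hX1 (E.mem (k + 1)))
  exact orient3_polar pa pb

/-- Consecutive sines have a positive product (they share one sign). -/
theorem sin_gap_mul_sin_gap_pos (hX1 : ∀ y ∈ X, ‖y‖ = 1)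
    (h0 : (0 : EuclideanSpace ℝ (Fin 3)) ∈ interior (convexHull ℝ (X : Set _)))
    (E : NbrEnum X y hy) (k : ℕ) :
    0 < Real.sin (azimuth y hy (E.nb (k + 1)) - azimuth y hy (E.nb k)) *
      Real.sin (azimuth y hy (E.nb 1) - azimuth y hy (E.nb 0)) := by
  set D := orient3 (tangentFrame y hy 0) (tangentFrame y hy 1) (tangentFrame y hy 2) with hD
  have ek := orient3_nb_eq_polar hX1 E k
  have e0 := orient3_nb_eq_polar hX1 E 0
  have rk := trad_pos_of_mem_fanNbrs hX1 (E.mem k)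
  have rk1 := trad_pos_of_mem_fanNbrs hX1 (E.mem (k + 1))
  have r0 := trad_pos_of_mem_fanNbrs hX1 (E.mem 0)
  have r1 := trad_pos_of_mem_fanNbrs hX1 (E.mem 1)
  -- `O_k · O_0 > 0`
  have hOO : 0 < orient3 y (E.nb k) (E.nb (k + 1)) * orient3 y (E.nb 0) (E.nb 1) := by
    rcases lt_or_gt_of_ne (orient3_nb_ne_zero hX1 h0 E 0) with hn | hp
    · have hk : orient3 y (E.nb k) (E.nb (k + 1)) < 0 := by
        rcases lt_or_gt_of_ne (orient3_nb_ne_zero hX1 h0 E k) with h | h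
        · exact h
        · exact absurd ((orient3_nb_pos_iff hX1 h0 E k).1 h) (not_lt.2 hn.le)
      exact mul_pos_of_neg_of_neg hk hn
    · exact mul_pos ((orient3_nb_pos_iff hX1 h0 E k).2 hp) hp
  rw [ek, e0] at hOO
  set sk := Real.sin (azimuth y hy (E.nb (k + 1)) - azimuth y hy (E.nb k))
  set s0 := Real.sin (azimuth y hy (E.nb 1) - azimuth y hy (E.nb 0))
  -- strip the positive factors and the square `D²`
  have hfac : trad y (E.nb k) * trad y (E.nb (k + 1)) * sk * D *
      (trad y (E.nb 0) * trad y (E.nb 1) * s0 * D) =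
      (trad y (E.nb k) * trad y (E.nb (k + 1)) * (trad y (E.nb 0) * trad y (E.nb 1)) * D ^ 2) *
        (sk * s0) := by ring
  rw [hfac] at hOO
  have hc : 0 ≤ trad y (E.nb k) * trad y (E.nb (k + 1)) * (trad y (E.nb 0) * trad y (E.nb 1)) *
      D ^ 2 := by positivity
  by_contra hle
  rw [not_lt] at hle
  have := mul_nonpos_of_nonneg_of_nonpos hc hle
  linarith

/-- **Every cyclically consecutive azimuth gap has positive sine.** If all sines were negative,
every gap `θ_{k+1} − θ_k` (`k + 1 < d`) and the wrap-around gap `θ_0 + 2π − θ_{d−1}` would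
exceed `π`, but they sum to `2π` and `d ≥ 3`. -/
theorem sin_azimuth_gap_pos (hX1 : ∀ y ∈ X, ‖y‖ = 1)
    (h0 : (0 : EuclideanSpace ℝ (Fin 3)) ∈ interior (convexHull ℝ (X : Set _)))
    (E : NbrEnum X y hy) (k : ℕ) :
    0 < Real.sin (azimuth y hy (E.nb (k + 1)) - azimuth y hy (E.nb k)) := by
  have hd := three_le_d hX1 h0 E
  set θ : ℕ → ℝ := fun j => azimuth y hy (E.nb j) with hθ
  -- it suffices that the FIRST sine is positive
  suffices h0pos : 0 < Real.sin (θ 1 - θ 0) by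
    have h := sin_gap_mul_sin_gap_pos hX1 h0 E k
    exact (mul_pos_iff_of_pos_right h0pos).1 h
  by_contra hle
  rw [not_lt] at hle
  have hs0 : Real.sin (θ 1 - θ 0) < 0 :=
    lt_of_le_of_ne hle (by
      have h := sin_gap_mul_sin_gap_pos hX1 h0 E 0
      exact fun he => by rw [he, mul_zero] at h; exact lt_irrefl _ h)
  -- then every sine is negative
  have hneg : ∀ j, Real.sin (θ (j + 1) - θ j) < 0 := by
    intro j
    have h := sin_gap_mul_sin_gap_pos hX1 h0 E j
    by_contra hj
    rw [not_lt] at hj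
    have := mul_nonpos_of_nonneg_of_nonpos hj hs0.le
    linarith
  -- ranges of the azimuths
  have hlo : ∀ j, -π < θ j := fun j => neg_pi_lt_azimuth y hy (E.nb j)
  have hhi : ∀ j, θ j ≤ π := fun j => azimuth_le_pi y hy (E.nb j)
  -- interior gaps exceed `π`
  have hgap : ∀ j, j + 1 < E.d → π < θ (j + 1) - θ j := by
    intro j hj
    have hmono : θ j < θ (j + 1) := E.mono j (j + 1) (Nat.lt_succ_self j) hj
    by_contra hle'
    rw [not_lt] at hle'
    have : 0 ≤ Real.sin (θ (j + 1) - θ j) :=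
      Real.sin_nonneg_of_nonneg_of_le_pi (by linarith) hle'
    linarith [hneg j]
  -- the wrap-around gap exceeds `π`
  have hwrap : π < θ 0 + 2 * π - θ (E.d - 1) := by
    have hper : θ (E.d - 1 + 1) = θ 0 := by
      show azimuth y hy (E.nb (E.d - 1 + 1)) = azimuth y hy (E.nb 0)
      rw [Nat.sub_add_cancel E.d_pos, show E.d = 0 + E.d by ring, E.periodic]
    have h := hneg (E.d - 1)
    rw [hper] at h
    by_contra hle'
    rw [not_lt] at hle'
    have h2 : Real.sin (θ 0 - θ (E.d - 1)) = Real.sin (θ 0 + 2 * π - θ (E.d - 1)) := by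
      rw [show θ 0 + 2 * π - θ (E.d - 1) = θ 0 - θ (E.d - 1) + 2 * π by ring, Real.sin_add_two_pi]
    have : 0 ≤ Real.sin (θ 0 + 2 * π - θ (E.d - 1)) :=
      Real.sin_nonneg_of_nonneg_of_le_pi (by linarith [hlo 0, hhi (E.d - 1)]) hle'
    rw [← h2] at this
    linarith
  -- sum the interior gaps: `(d-1) π ≤ θ (d-1) - θ 0`
  have hsum : ((E.d - 1 : ℕ) : ℝ) * π ≤ θ (E.d - 1) - θ 0 := by
    have htel : ∑ j ∈ range (E.d - 1), (θ (j + 1) - θ j) = θ (E.d - 1) - θ 0 :=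
      Finset.sum_range_sub θ (E.d - 1)
    have hle' : ∑ j ∈ range (E.d - 1), π ≤ ∑ j ∈ range (E.d - 1), (θ (j + 1) - θ j) :=
      Finset.sum_le_sum fun j hj => (hgap j (by have := mem_range.1 hj; omega)).le
    rw [htel, sum_const, card_range, nsmul_eq_mul] at hle'
    exact hle'
  have hd' : (3 : ℝ) ≤ ((E.d - 1 : ℕ) : ℝ) + 1 := by
    have : ((E.d - 1 : ℕ) : ℝ) = (E.d : ℝ) - 1 := by
      rw [Nat.cast_sub (by omega : 1 ≤ E.d)]; simp
    rw [this]
    have : (3 : ℝ) ≤ (E.d : ℝ) := by exact_mod_cast hd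
    linarith
  nlinarith [Real.pi_pos]

/-- Interior azimuth gaps are `< π`. -/
theorem azimuth_gap_lt_pi (hX1 : ∀ y ∈ X, ‖y‖ = 1)
    (h0 : (0 : EuclideanSpace ℝ (Fin 3)) ∈ interior (convexHull ℝ (X : Set _)))
    (E : NbrEnum X y hy) {k : ℕ} (hk : k + 1 < E.d) :
    azimuth y hy (E.nb (k + 1)) - azimuth y hy (E.nb k) < π := by
  have hmono := E.mono k (k + 1) (Nat.lt_succ_self k) hk
  have hs := sin_azimuth_gap_pos hX1 h0 E k
  by_contra hle
  rw [not_lt] at hle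
  have h1 : azimuth y hy (E.nb (k + 1)) - azimuth y hy (E.nb k) - π < π := by
    linarith [neg_pi_lt_azimuth y hy (E.nb k), azimuth_le_pi y hy (E.nb (k + 1)), Real.pi_pos]
  have : Real.sin (azimuth y hy (E.nb (k + 1)) - azimuth y hy (E.nb k)) ≤ 0 := by
    rw [show azimuth y hy (E.nb (k + 1)) - azimuth y hy (E.nb k) =
      (azimuth y hy (E.nb (k + 1)) - azimuth y hy (E.nb k) - π) + π by ring, Real.sin_add_pi]
    exact neg_nonpos.2 (Real.sin_nonneg_of_nonneg_of_le_pi (by linarith) h1.le)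
  linarith

/-- The wrap-around azimuth gap is `< π`. -/
theorem azimuth_wrap_gap_lt_pi (hX1 : ∀ y ∈ X, ‖y‖ = 1)
    (h0 : (0 : EuclideanSpace ℝ (Fin 3)) ∈ interior (convexHull ℝ (X : Set _)))
    (E : NbrEnum X y hy) :
    azimuth y hy (E.nb 0) + 2 * π - azimuth y hy (E.nb (E.d - 1)) < π := by
  have hs := sin_azimuth_gap_pos hX1 h0 E (E.d - 1)
  have hper : E.nb (E.d - 1 + 1) = E.nb 0 := by
    rw [Nat.sub_add_cancel E.d_pos, show E.d = 0 + E.d by ring, E.periodic]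
  rw [hper] at hs
  set g := azimuth y hy (E.nb 0) + 2 * π - azimuth y hy (E.nb (E.d - 1)) with hg
  have hsg : Real.sin (azimuth y hy (E.nb 0) - azimuth y hy (E.nb (E.d - 1))) = Real.sin g := by
    rw [hg, show azimuth y hy (E.nb 0) + 2 * π - azimuth y hy (E.nb (E.d - 1)) =
      azimuth y hy (E.nb 0) - azimuth y hy (E.nb (E.d - 1)) + 2 * π by ring, Real.sin_add_two_pi]
  rw [hsg] at hs
  by_contra hle
  rw [not_lt] at hle
  have hd := three_le_d hX1 h0 E
  have hg2 : g - π ≤ π := by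
    have hlt : azimuth y hy (E.nb 0) < azimuth y hy (E.nb (E.d - 1)) :=
      E.mono 0 (E.d - 1) (by omega) (by omega)
    rw [hg]; linarith
  have : Real.sin g ≤ 0 := by
    rw [show g = (g - π) + π by ring, Real.sin_add_pi]
    exact neg_nonpos.2 (Real.sin_nonneg_of_nonneg_of_le_pi (by linarith) hg2)
  linarith

/-- **The common sign of the orientations is the handedness of the frame.** -/
theorem orient3_nb_pos_iff_det_pos (hX1 : ∀ y ∈ X, ‖y‖ = 1)
    (h0 : (0 : EuclideanSpace ℝ (Fin 3)) ∈ interior (convexHull ℝ (X : Set _)))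
    (E : NbrEnum X y hy) (k : ℕ) :
    0 < orient3 y (E.nb k) (E.nb (k + 1)) ↔
      0 < orient3 (tangentFrame y hy 0) (tangentFrame y hy 1) (tangentFrame y hy 2) := by
  rw [orient3_nb_eq_polar hX1 E k]
  have hc : 0 < trad y (E.nb k) * trad y (E.nb (k + 1)) *
      Real.sin (azimuth y hy (E.nb (k + 1)) - azimuth y hy (E.nb k)) :=
    mul_pos (mul_pos (trad_pos_of_mem_fanNbrs hX1 (E.mem k))
      (trad_pos_of_mem_fanNbrs hX1 (E.mem (k + 1)))) (sin_azimuth_gap_pos hX1 h0 E k)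
  exact mul_pos_iff_of_pos_left hc

/-- **`σ_H` is the forward azimuth successor when the tangent frame is right-handed**
(`det > 0`): `succV X y (nb k) = nb (k + 1)` for every `k`. -/
theorem succV_nb_of_det_pos (hX1 : ∀ y ∈ X, ‖y‖ = 1)
    (h0 : (0 : EuclideanSpace ℝ (Fin 3)) ∈ interior (convexHull ℝ (X : Set _)))
    (E : NbrEnum X y hy)
    (hdet : 0 < orient3 (tangentFrame y hy 0) (tangentFrame y hy 1) (tangentFrame y hy 2))
    (k : ℕ) : succV X y (E.nb k) = E.nb (k + 1) :=
  succV_nb_forward hX1 h0 E ((orient3_nb_pos_iff_det_pos hX1 h0 E 0).2 hdet) k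

/-- **`σ_H` is the backward azimuth successor when the tangent frame is left-handed**
(`det < 0`): `succV X y (nb (k + 1)) = nb k` for every `k`. -/
theorem succV_nb_of_det_neg (hX1 : ∀ y ∈ X, ‖y‖ = 1)
    (h0 : (0 : EuclideanSpace ℝ (Fin 3)) ∈ interior (convexHull ℝ (X : Set _)))
    (E : NbrEnum X y hy)
    (hdet : orient3 (tangentFrame y hy 0) (tangentFrame y hy 1) (tangentFrame y hy 2) < 0)
    (k : ℕ) : succV X y (E.nb (k + 1)) = E.nb k := by
  refine succV_nb_backward hX1 h0 E ?_ k
  rcases lt_or_gt_of_ne (orient3_nb_ne_zero hX1 h0 E 0) with h | h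
  · exact h
  · exact absurd ((orient3_nb_pos_iff_det_pos hX1 h0 E 0).1 h) (not_lt.2 hdet.le)

end HullRotSys

end Summit.Ventures.Crystal3D
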